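import Literature.Probability.LatticeModels.PointwiseScalingLimitEtaExists
import HarnessLib

/-!
# Lossless transfer under axial doubling (line `Sketch`, stub S2 `stub_floorOfDoubling`)

What: stub `stub_floorOfDoubling` (S2, card volume-threshold-split, first lemma) of the line `Sketch`
for the crux `SubPtolemyFloor` (item stmt-CriticalPhenomena-15703, route `SubPtolemyInterlacing`):
for the critical nearest-neighbour Ising two-point function `G = criticalTwoPoint 3` on `ℤ³`, with
`g(n) := G(n e₁)` and `χ_n := Σ_{x ∈ box 3 n} G x`, axial doubling `κ g(n) ≤ g(2n)` (`n ≥ 1`) with ANY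
`κ > 1/8 = 2^{-3}` makes the transfer "integrated floor ⇒ axial floor" LOSSLESS:
`χ_n ≥ c n^{3-a₀}` for all `n ≥ 1` gives `g(n) ≥ c' n^{-a₀}` for all `n ≥ 1`.

Proof sketch (scale-locality). KEY LEMMA `floorOfDoubling_boxSum_le_of_doubling`:
`χ_n ≤ D n³ g(n)` for all `n ≥ 1`, by strong induction on `n` with a cut-off `N₀`:
* threshold (`floorOfDoubling_exists_threshold`): `θ := 4κ + 1/2 > 1`, `ρ := θ/(8κ) < 1`; pick
  `N₀ ≥ 1` with `(n+1)³ ≤ θ n³` for `n ≥ N₀`;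
* base `1 ≤ n ≤ N₀`: `χ_n ≤ #(box 3 n) ≤ 27 n³ ≤ (27/g(N₀)) n³ g(n)` (`G ≤ 1`, axis antitone);
* step `n > N₀`: with `m := ⌈n/2⌉`, `χ_n = χ_m + Σ_{m < ‖x‖_∞ ≤ n} G x`; on the shell
  `G x ≤ g(‖x‖_∞) ≤ κ⁻¹ g(2‖x‖_∞) ≤ κ⁻¹ g(n)` (Messager–Miracle-Solé sandwich, doubling, antitone), so the
  shell is `≤ (27/κ) n³ g(n)`; inside, `χ_m ≤ D m³ g(m) ≤ D (θ n³/8) κ⁻¹ g(n) = D ρ n³ g(n)`; total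
  `≤ (27/κ + Dρ) n³ g(n) ≤ D n³ g(n)` as soon as `D (1-ρ) ≥ 27/κ`;
* `D := 27/g(N₀) + 27/(κ(1-ρ))` serves both branches.
CONCLUSION: `c n^{3-a₀} ≤ χ_n ≤ D n³ g(n)` and `n^{3-a₀} = n³ · n^{-a₀}` give `g(n) ≥ (c/D) n^{-a₀}`.

Sources: tree facts `criticalTwoPoint_axis_antitone`, `criticalTwoPoint_axis_pos`,
`criticalTwoPoint_axis_sandwich` (Messager–Miracle-Solé), `criticalTwoPoint_le_one'`, `card_box`,
`mem_box_iff_supNorm_le`, `box_mono`; the folding pattern is that of Aizenman–Duminil-Copin,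
Ann. Math. 194 (2021), §5.1 eq. (5.3) [AizenmanDuminilCopinAnnals2021]. Elementary given the tree.
-/

noncomputable section

namespace Summit.CriticalPhenomena.Ising3DConformalLimit.SubPtolemyFloorSketch

open scoped BigOperators Classical
open Finset Literature.Probability.LatticeModels

/-! ## Axis bookkeeping -/

/-- `n • e₁ = Pi.single 0 n` on `ℤ³`. [folklore] -/
theorem floorOfDoubling_natCast_zsmul_e1 (n : ℕ) :
    ((n : ℤ) • (Pi.single 0 1 : Site 3)) = Pi.single 0 (n : ℤ) := by
  ext j
  fin_cases j <;> simp

/-- Doubling + axis monotonicity: `g(k) ≤ κ⁻¹ g(n)` whenever `1 ≤ k` and `n ≤ 2k`. [folklore] -/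
theorem floorOfDoubling_axis_le_of_doubling {κ : ℝ} (hκ : 0 < κ)
    (hd : ∀ n : ℕ, 1 ≤ n →
      κ * criticalTwoPoint 3 ((n : ℤ) • (Pi.single 0 1 : Site 3)) ≤
        criticalTwoPoint 3 (((2 * n : ℕ) : ℤ) • (Pi.single 0 1 : Site 3)))
    {k n : ℕ} (hk : 1 ≤ k) (hkn : n ≤ 2 * k) :
    criticalTwoPoint 3 (Pi.single 0 (k : ℤ)) ≤
      κ⁻¹ * criticalTwoPoint 3 (Pi.single 0 (n : ℤ)) := by
  have h1 := hd k hk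
  rw [floorOfDoubling_natCast_zsmul_e1, floorOfDoubling_natCast_zsmul_e1] at h1
  have h2 : criticalTwoPoint 3 (Pi.single 0 ((2 * k : ℕ) : ℤ)) ≤
      criticalTwoPoint 3 (Pi.single 0 (n : ℤ)) :=
    criticalTwoPoint_axis_antitone hkn
  rw [le_inv_mul_iff₀ hκ]
  exact h1.trans h2

/-- Scale-locality on a shell: `G x ≤ κ⁻¹ g(n)` whenever `1 ≤ ‖x‖_∞` and `n ≤ 2‖x‖_∞`
(Messager–Miracle-Solé `G x ≤ g(‖x‖_∞)`, then doubling and monotonicity).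
[cite: AizenmanDuminilCopinAnnals2021, §5.1 eq. (5.3)] -/
theorem floorOfDoubling_twoPoint_le_of_doubling {κ : ℝ} (hκ : 0 < κ)
    (hd : ∀ n : ℕ, 1 ≤ n →
      κ * criticalTwoPoint 3 ((n : ℤ) • (Pi.single 0 1 : Site 3)) ≤
        criticalTwoPoint 3 (((2 * n : ℕ) : ℤ) • (Pi.single 0 1 : Site 3)))
    {n : ℕ} {x : Site 3} (hx : 1 ≤ Site.supNorm x) (hxn : n ≤ 2 * Site.supNorm x) :
    criticalTwoPoint 3 x ≤ κ⁻¹ * criticalTwoPoint 3 (Pi.single 0 (n : ℤ)) :=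
  (criticalTwoPoint_axis_sandwich hx).2.trans (floorOfDoubling_axis_le_of_doubling hκ hd hx hxn)

/-! ## Counting -/

/-- `#(box 3 n) = (2n+1)³ ≤ 27 n³` for `n ≥ 1`. [folklore] -/
theorem floorOfDoubling_card_box_three_le {n : ℕ} (hn : 1 ≤ n) :
    (#(box 3 n) : ℝ) ≤ 27 * (n : ℝ) ^ 3 := by
  rw [card_box]
  push_cast
  have h1 : (1 : ℝ) ≤ n := by exact_mod_cast hn
  nlinarith [pow_le_pow_left₀ (by positivity : (0 : ℝ) ≤ 2 * n + 1)
    (by linarith : (2 : ℝ) * n + 1 ≤ 3 * n) 3]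

/-- The trivial bound `χ_n ≤ #(box 3 n) ≤ 27 n³` (`G ≤ 1`). [folklore] -/
theorem floorOfDoubling_boxSum_le {n : ℕ} (hn : 1 ≤ n) :
    ∑ x ∈ box 3 n, criticalTwoPoint 3 x ≤ 27 * (n : ℝ) ^ 3 :=
  calc ∑ x ∈ box 3 n, criticalTwoPoint 3 x ≤ #(box 3 n) • (1 : ℝ) :=
        sum_le_card_nsmul _ _ 1 fun x _ => criticalTwoPoint_le_one' x
    _ = #(box 3 n) := by rw [nsmul_eq_mul, mul_one]
    _ ≤ 27 * (n : ℝ) ^ 3 := floorOfDoubling_card_box_three_le hn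

/-- The shell bound: `Σ_{x ∈ box n ∖ box m} G x ≤ 27 n³ κ⁻¹ g(n)` when `1 ≤ m` and `n ≤ 2(m+1)`
(every shell site has `m < ‖x‖_∞`, hence `n ≤ 2‖x‖_∞`). [folklore] -/
theorem floorOfDoubling_shellSum_le {κ : ℝ} (hκ : 0 < κ)
    (hd : ∀ n : ℕ, 1 ≤ n →
      κ * criticalTwoPoint 3 ((n : ℤ) • (Pi.single 0 1 : Site 3)) ≤
        criticalTwoPoint 3 (((2 * n : ℕ) : ℤ) • (Pi.single 0 1 : Site 3)))
    {m n : ℕ} (hm : 1 ≤ m) (hn : 1 ≤ n) (hnm : n ≤ 2 * (m + 1)) :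
    ∑ x ∈ box 3 n \ box 3 m, criticalTwoPoint 3 x ≤
      27 * (n : ℝ) ^ 3 * (κ⁻¹ * criticalTwoPoint 3 (Pi.single 0 (n : ℤ))) := by
  have hpt : ∀ x ∈ box 3 n \ box 3 m,
      criticalTwoPoint 3 x ≤ κ⁻¹ * criticalTwoPoint 3 (Pi.single 0 (n : ℤ)) := by
    intro x hx
    rw [mem_sdiff, mem_box_iff_supNorm_le, mem_box_iff_supNorm_le] at hx
    exact floorOfDoubling_twoPoint_le_of_doubling hκ hd (by omega) (by omega)
  have hcard : (#(box 3 n \ box 3 m) : ℝ) ≤ 27 * (n : ℝ) ^ 3 :=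
    calc (#(box 3 n \ box 3 m) : ℝ) ≤ #(box 3 n) := by exact_mod_cast card_le_card sdiff_subset
      _ ≤ 27 * (n : ℝ) ^ 3 := floorOfDoubling_card_box_three_le hn
  have hnn : 0 ≤ κ⁻¹ * criticalTwoPoint 3 (Pi.single 0 (n : ℤ)) :=
    mul_nonneg (inv_nonneg.2 hκ.le) (criticalTwoPoint_nonneg' _)
  calc ∑ x ∈ box 3 n \ box 3 m, criticalTwoPoint 3 x
      ≤ #(box 3 n \ box 3 m) • (κ⁻¹ * criticalTwoPoint 3 (Pi.single 0 (n : ℤ))) :=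
        sum_le_card_nsmul _ _ _ hpt
    _ = #(box 3 n \ box 3 m) * (κ⁻¹ * criticalTwoPoint 3 (Pi.single 0 (n : ℤ))) := nsmul_eq_mul _ _
    _ ≤ 27 * (n : ℝ) ^ 3 * (κ⁻¹ * criticalTwoPoint 3 (Pi.single 0 (n : ℤ))) :=
        mul_le_mul_of_nonneg_right hcard hnn

/-! ## The threshold and the key lemma -/

/-- Threshold: for `θ > 1` there is `N₀ ≥ 1` with `(n+1)³ ≤ θ n³` for all `n ≥ N₀`
(`(1+1/n)³ ≤ 1 + 7/n`). [folklore] -/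
theorem floorOfDoubling_exists_threshold {θ : ℝ} (hθ : 1 < θ) :
    ∃ N₀ : ℕ, 1 ≤ N₀ ∧ ∀ n : ℕ, N₀ ≤ n → ((n : ℝ) + 1) ^ 3 ≤ θ * (n : ℝ) ^ 3 := by
  have hθ' : 0 < θ - 1 := sub_pos.2 hθ
  obtain ⟨N₀, hN₀⟩ := exists_nat_ge (7 / (θ - 1) + 1)
  have hpos : (0 : ℝ) < 7 / (θ - 1) := div_pos (by norm_num) hθ'
  have hN₀1 : 1 ≤ N₀ := by
    have h : (1 : ℝ) ≤ N₀ := by linarith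
    exact_mod_cast h
  refine ⟨N₀, hN₀1, fun n hn => ?_⟩
  have hn' : (N₀ : ℝ) ≤ n := by exact_mod_cast hn
  have h1 : (1 : ℝ) ≤ n := by exact_mod_cast hN₀1.trans hn
  have h7 : 7 ≤ (θ - 1) * n := by
    have h : 7 / (θ - 1) ≤ n := by linarith
    rw [div_le_iff₀ hθ'] at h
    linarith
  have hn2 : (0 : ℝ) ≤ (n : ℝ) ^ 2 := sq_nonneg _
  nlinarith [mul_le_mul_of_nonneg_left h7 hn2,
    mul_nonneg (sub_nonneg.2 h1) (by positivity : (0 : ℝ) ≤ 4 * n + 1)]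

/-- **Key lemma (scale-locality under doubling).** If `κ g(n) ≤ g(2n)` for all `n ≥ 1` with
`κ > 1/8`, then the box sum is carried by its top scale: `χ_n ≤ D n³ g(n)` for all `n ≥ 1`.
[cite: AizenmanDuminilCopinAnnals2021, §5.1 eq. (5.3)] -/
theorem floorOfDoubling_boxSum_le_of_doubling {κ : ℝ} (hκ : 1 / 8 < κ)
    (hd : ∀ n : ℕ, 1 ≤ n →
      κ * criticalTwoPoint 3 ((n : ℤ) • (Pi.single 0 1 : Site 3)) ≤
        criticalTwoPoint 3 (((2 * n : ℕ) : ℤ) • (Pi.single 0 1 : Site 3))) :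
    ∃ D : ℝ, 0 < D ∧ ∀ n : ℕ, 1 ≤ n →
      ∑ x ∈ box 3 n, criticalTwoPoint 3 x ≤
        D * (n : ℝ) ^ 3 * criticalTwoPoint 3 (Pi.single 0 (n : ℤ)) := by
  have hκ0 : 0 < κ := lt_trans (by norm_num) hκ
  have hθ1 : (1 : ℝ) < 4 * κ + 1 / 2 := by linarith
  obtain ⟨N₀, hN₀, hthr⟩ := floorOfDoubling_exists_threshold hθ1
  have h8κ : (0 : ℝ) < 8 * κ := by positivity
  obtain ⟨ρ, hρ⟩ : ∃ ρ : ℝ, ρ = (4 * κ + 1 / 2) / (8 * κ) := ⟨_, rfl⟩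
  have hρ1 : ρ < 1 := by rw [hρ, div_lt_one h8κ]; linarith
  have h1ρ : 0 < 1 - ρ := sub_pos.2 hρ1
  have hg0 : 0 < criticalTwoPoint 3 (Pi.single 0 (N₀ : ℤ)) := criticalTwoPoint_axis_pos N₀
  obtain ⟨D, hD⟩ : ∃ D : ℝ,
      D = 27 / criticalTwoPoint 3 (Pi.single 0 (N₀ : ℤ)) + 27 / (κ * (1 - ρ)) := ⟨_, rfl⟩
  have hA : 0 < 27 / criticalTwoPoint 3 (Pi.single 0 (N₀ : ℤ)) := div_pos (by norm_num) hg0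
  have hB : 0 < 27 / (κ * (1 - ρ)) := div_pos (by norm_num) (mul_pos hκ0 h1ρ)
  have hDA : 27 / criticalTwoPoint 3 (Pi.single 0 (N₀ : ℤ)) ≤ D := by rw [hD]; linarith
  have hDB : 27 / (κ * (1 - ρ)) ≤ D := by rw [hD]; linarith
  have hDpos : 0 < D := by rw [hD]; linarith
  -- the absorption inequality `27/κ + Dρ ≤ D`
  have hkey : 27 * κ⁻¹ + D * ρ ≤ D := by
    have h1 : 27 ≤ D * (κ * (1 - ρ)) := (div_le_iff₀ (mul_pos hκ0 h1ρ)).1 hDB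
    have h2 : 27 * κ⁻¹ ≤ D * (1 - ρ) := by
      rw [← div_eq_mul_inv, div_le_iff₀ hκ0]
      linarith [h1]
    linarith
  refine ⟨D, hDpos, fun n => ?_⟩
  induction n using Nat.strong_induction_on with
  | _ n ih =>
  intro hn
  have hgn : 0 < criticalTwoPoint 3 (Pi.single 0 (n : ℤ)) := criticalTwoPoint_axis_pos n
  have hn3 : (0 : ℝ) ≤ (n : ℝ) ^ 3 := by positivity
  by_cases hsmall : n ≤ N₀
  · -- base: `χ_n ≤ 27 n³ ≤ (27 / g N₀) n³ g n`
    have hmono : criticalTwoPoint 3 (Pi.single 0 (N₀ : ℤ)) ≤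
        criticalTwoPoint 3 (Pi.single 0 (n : ℤ)) :=
      criticalTwoPoint_axis_antitone hsmall
    calc ∑ x ∈ box 3 n, criticalTwoPoint 3 x ≤ 27 * (n : ℝ) ^ 3 := floorOfDoubling_boxSum_le hn
      _ = 27 / criticalTwoPoint 3 (Pi.single 0 (N₀ : ℤ)) * (n : ℝ) ^ 3 *
            criticalTwoPoint 3 (Pi.single 0 (N₀ : ℤ)) := by
          field_simp
      _ ≤ 27 / criticalTwoPoint 3 (Pi.single 0 (N₀ : ℤ)) * (n : ℝ) ^ 3 *
            criticalTwoPoint 3 (Pi.single 0 (n : ℤ)) :=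
          mul_le_mul_of_nonneg_left hmono (mul_nonneg hA.le hn3)
      _ ≤ D * (n : ℝ) ^ 3 * criticalTwoPoint 3 (Pi.single 0 (n : ℤ)) := by
          rw [mul_assoc, mul_assoc]
          exact mul_le_mul_of_nonneg_right hDA (mul_nonneg hn3 hgn.le)
  · -- step: split at `m = ⌈n/2⌉`
    have hlt : N₀ < n := not_le.1 hsmall
    obtain ⟨m, hm⟩ : ∃ m : ℕ, m = (n + 1) / 2 := ⟨_, rfl⟩
    have hm1 : 1 ≤ m := by omega
    have hmn : m < n := by omega
    have hn2m : n ≤ 2 * m := by omega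
    have h2m : 2 * m ≤ n + 1 := by omega
    have ihm := ih m hmn hm1
    have hgm : criticalTwoPoint 3 (Pi.single 0 (m : ℤ)) ≤
        κ⁻¹ * criticalTwoPoint 3 (Pi.single 0 (n : ℤ)) :=
      floorOfDoubling_axis_le_of_doubling hκ0 hd hm1 hn2m
    have hmr : (m : ℝ) ≤ ((n : ℝ) + 1) / 2 := by
      have h : ((2 * m : ℕ) : ℝ) ≤ ((n + 1 : ℕ) : ℝ) := by exact_mod_cast h2m
      push_cast at h
      linarith
    have hm3 : (m : ℝ) ^ 3 ≤ (4 * κ + 1 / 2) / 8 * (n : ℝ) ^ 3 :=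
      calc (m : ℝ) ^ 3 ≤ (((n : ℝ) + 1) / 2) ^ 3 := pow_le_pow_left₀ (by positivity) hmr 3
        _ = ((n : ℝ) + 1) ^ 3 / 8 := by ring
        _ ≤ (4 * κ + 1 / 2) * (n : ℝ) ^ 3 / 8 :=
            div_le_div_of_nonneg_right (hthr n hlt.le) (by norm_num)
        _ = (4 * κ + 1 / 2) / 8 * (n : ℝ) ^ 3 := by ring
    have hshell := floorOfDoubling_shellSum_le hκ0 hd hm1 hn (by omega : n ≤ 2 * (m + 1))
    have hsplit :
        ∑ x ∈ box 3 n, criticalTwoPoint 3 x =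
          ∑ x ∈ box 3 n \ box 3 m, criticalTwoPoint 3 x + ∑ x ∈ box 3 m, criticalTwoPoint 3 x :=
      (sum_sdiff (box_mono 3 hmn.le)).symm
    have hinner : ∑ x ∈ box 3 m, criticalTwoPoint 3 x ≤
        D * ρ * (n : ℝ) ^ 3 * criticalTwoPoint 3 (Pi.single 0 (n : ℤ)) :=
      calc ∑ x ∈ box 3 m, criticalTwoPoint 3 x
          ≤ D * (m : ℝ) ^ 3 * criticalTwoPoint 3 (Pi.single 0 (m : ℤ)) := ihm
        _ ≤ D * ((4 * κ + 1 / 2) / 8 * (n : ℝ) ^ 3) *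
              (κ⁻¹ * criticalTwoPoint 3 (Pi.single 0 (n : ℤ))) :=
            mul_le_mul (mul_le_mul_of_nonneg_left hm3 hDpos.le) hgm (criticalTwoPoint_nonneg' _)
              (mul_nonneg hDpos.le (by positivity))
        _ = D * ρ * (n : ℝ) ^ 3 * criticalTwoPoint 3 (Pi.single 0 (n : ℤ)) := by
            rw [hρ]
            field_simp
    calc ∑ x ∈ box 3 n, criticalTwoPoint 3 x
        = ∑ x ∈ box 3 n \ box 3 m, criticalTwoPoint 3 x + ∑ x ∈ box 3 m, criticalTwoPoint 3 x :=
          hsplit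
      _ ≤ 27 * (n : ℝ) ^ 3 * (κ⁻¹ * criticalTwoPoint 3 (Pi.single 0 (n : ℤ))) +
            D * ρ * (n : ℝ) ^ 3 * criticalTwoPoint 3 (Pi.single 0 (n : ℤ)) :=
          add_le_add hshell hinner
      _ = (27 * κ⁻¹ + D * ρ) * ((n : ℝ) ^ 3 * criticalTwoPoint 3 (Pi.single 0 (n : ℤ))) := by ring
      _ ≤ D * ((n : ℝ) ^ 3 * criticalTwoPoint 3 (Pi.single 0 (n : ℤ))) :=
          mul_le_mul_of_nonneg_right hkey (mul_nonneg hn3 hgn.le)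
      _ = D * (n : ℝ) ^ 3 * criticalTwoPoint 3 (Pi.single 0 (n : ℤ)) := by ring

/-! ## The stub -/

/-- **S2 — lossless transfer under axial doubling `κ > 1/8` (card volume-threshold-split, first lemma).**
`g(2n) ≥ κ g(n)` (`n ≥ 1`, `κ > 2^{-3}`) and `χ_n ≥ c n^{3-a₀}` ⟹ `g(n) ≥ c' n^{-a₀}`.
Proof: `c n^{3-a₀} ≤ χ_n ≤ D n³ g(n)` (`floorOfDoubling_boxSum_le_of_doubling`) and
`n^{3-a₀} = n³ n^{-a₀}`, with `c' = c / D`. [cite: AizenmanDuminilCopinAnnals2021, §5.1 eq. (5.3) (MMS folding pattern)] -/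
theorem stub_floorOfDoubling :
    ∀ κ a₀ : ℝ, 1 / 8 < κ →
      (∀ n : ℕ, 1 ≤ n →
        κ * criticalTwoPoint 3 ((n : ℤ) • (Pi.single 0 1 : Site 3)) ≤
          criticalTwoPoint 3 (((2 * n : ℕ) : ℤ) • (Pi.single 0 1 : Site 3))) →
      (∃ c : ℝ, 0 < c ∧ ∀ n : ℕ, 1 ≤ n →
        c * (n : ℝ) ^ (3 - a₀) ≤ ∑ x ∈ box 3 n, criticalTwoPoint 3 x) →
      ∃ c : ℝ, 0 < c ∧ ∀ n : ℕ, 1 ≤ n →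
        c * (n : ℝ) ^ (-a₀) ≤ criticalTwoPoint 3 ((n : ℤ) • (Pi.single 0 1 : Site 3)) := by
  intro κ a₀ hκ hd hs
  obtain ⟨c, hc, hcs⟩ := hs
  obtain ⟨D, hD, hDs⟩ := floorOfDoubling_boxSum_le_of_doubling hκ hd
  refine ⟨c / D, div_pos hc hD, fun n hn => ?_⟩
  rw [floorOfDoubling_natCast_zsmul_e1]
  have hn0 : (0 : ℝ) < n := by exact_mod_cast hn
  have hsplit : (n : ℝ) ^ (3 - a₀) = (n : ℝ) ^ 3 * (n : ℝ) ^ (-a₀) := by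
    rw [sub_eq_add_neg, Real.rpow_add hn0, Real.rpow_ofNat]
  have h1 := hcs n hn
  rw [hsplit] at h1
  have h3 : c * ((n : ℝ) ^ 3 * (n : ℝ) ^ (-a₀)) ≤
      D * (n : ℝ) ^ 3 * criticalTwoPoint 3 (Pi.single 0 (n : ℤ)) := h1.trans (hDs n hn)
  have hn3 : (0 : ℝ) < (n : ℝ) ^ 3 := by positivity
  rw [div_mul_eq_mul_div, div_le_iff₀ hD]
  refine le_of_mul_le_mul_left ?_ hn3
  calc (n : ℝ) ^ 3 * (c * (n : ℝ) ^ (-a₀)) = c * ((n : ℝ) ^ 3 * (n : ℝ) ^ (-a₀)) := by ring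
    _ ≤ D * (n : ℝ) ^ 3 * criticalTwoPoint 3 (Pi.single 0 (n : ℤ)) := h3
    _ = (n : ℝ) ^ 3 * (criticalTwoPoint 3 (Pi.single 0 (n : ℤ)) * D) := by ring

end Summit.CriticalPhenomena.Ising3DConformalLimit.SubPtolemyFloorSketch

end
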